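import Mathlib
import Literature.Probability.Percolation.PercolationProofs
import Literature.Probability.Percolation.ConditionalPositiveAssociation
import Literature.Probability.Percolation.TwoClusterConditionalAssociation
import Literature.Probability.Percolation.TwoClusterConditionalAssociationProofs
import HarnessLib

/-! # Crux `PercNearOneGluing.AdditiveGluing` (stmt-CriticalPhenomena-4576), line
`subuniform-dead-pocket-maximum` — helper: Kozma–Nitzan Lemma 3 for MIXED conditioning events

Helper file for the crux (siege attempt k = 31 on `stub_goodStep`, variation "induction on pivotal
edges"); lands with `--supports stmt-CriticalPhenomena-4576`.

## Content

Kozma–Nitzan, arXiv:2401.12397, Lemma 3 (pp. 6–7) compares `P(a₁ ↔ b, Q)` with `P(a₂ ↔ b, Q)`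
when `P(a₁ ↔ b) ≤ P(a₂ ↔ b) + d`, for `Q` increasing and determined by the open cluster of `a₂`
(part (i)) or decreasing and determined by the open cluster of `a₁` (part (ii)).  Here we prove the
common generalisation to MIXED events: `Q` is (the indicator of) a function of the pair of open edge
clusters `(C_{a₂}, C_{a₁})`, increasing in `C_{a₂}` and decreasing in `C_{a₁}` — hypothesis
`ω ∈ Q`, `C_{a₂} ω ⊆ C_{a₂} ω'`, `C_{a₁} ω' ⊆ C_{a₁} ω` ⇒ `ω' ∈ Q` — with the conclusion of
part (ii): `P({a₁ ↔ b} ∩ Q) ≤ P({a₂ ↔ b} ∩ Q) + d` (`knLemma3Mixed`).  The model case, needed by the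
σ-decomposition of an observer whose open star is `S`, is `Q_S = {S ↔ a₂} ∩ {S ↮ a₁}`
(`knLemma3Mixed_setObserver`): it is neither increasing in `C_{a₂}` alone nor decreasing in
`C_{a₁}` alone, so neither printed part applies, but it is mixed-monotone.  Consequence recorded in
the siege evidence note (not formalised here): KN Question 9 holds for `|A| = 2`, i.e. Lemma 3(i)'s
conclusion at `Q = {o ↔ a₂}` holds already when `a₁` is the minimiser in `G ∖ o`.

## Proof

Exactly KN's proof of Lemma 3(ii), with BOTH correlation steps supplied by van den
Berg–Häggström–Kahn 2006, Thm. 1.5 (proved in the tree: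
`Literature.Probability.Percolation.BHK2006_twoClusterConditionalAssociation_holds`; given
`{s ↮ t}`, functions of `(C_s, C_t)` increasing in `C_s` and decreasing in `C_t` are positively
associated), used with `s = a₂`, `t = a₁`, `D = {a₂ ↮ a₁}`:
* `f = 1_Q`, `g = 1{a₂ ↔ b}` (increasing in `C_{a₂}`): `μ(D ∩ Q) μ(D ∩ {a₂↔b}) ≤ μ(D) μ(D ∩ Q ∩ {a₂↔b})`;
* `f = 1_Q`, `g = −1{a₁ ↔ b}` (decreasing in `C_{a₁}`): `μ(D) μ(D ∩ Q ∩ {a₁↔b}) ≤ μ(D ∩ Q) μ(D ∩ {a₁↔b})`.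
With `m = μ(D)`, `q = μ(D ∩ Q) ≤ m`, `x_i = μ(D ∩ {a_i↔b})`, `y_i = μ(D ∩ Q ∩ {a_i↔b})` and
`x₁ ≤ x₂ + d` (the hypothesis minus the common part on `{a₁ ↔ a₂}`):
`m y₁ ≤ q x₁ ≤ q x₂ + q d ≤ m y₂ + m d`, so `y₁ ≤ y₂ + d`; adding back the parts on `{a₁ ↔ a₂}`,
where `{a₁ ↔ b} = {a₂ ↔ b}`, gives the claim.  No new definitions (the two-variable indicator of the
closure of `Q` is written inline, as in the sibling `knLemma3i`).
-/

namespace Summit.CriticalPhenomena.PercolationContinuityZ3.Theorems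

open MeasureTheory Set
open Literature.Probability.LatticeModels (prodBernoulli)
open Literature.Probability.Percolation (BondConfig openConn openGraph openEdgeCluster
  connIndicatorFn monotone_connIndicatorFn connIndicatorFn_openEdgeCluster
  reachable_iff_exists_mem_openEdgeCluster measurableSet_openConn_holds
  BHK2006_twoClusterConditionalAssociation_holds)

noncomputable section
open Classical

section General

universe u

variable {V : Type u}

/-- The inline two-variable indicator used below: `1` at `(C, D)` iff some `ω' ∈ Q` has
`C_s ω' ⊆ C` and `D ⊆ C_t ω'` (the mixed closure of `Q`).  Under the mixed closure hypothesis it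
evaluates to `1_Q ω` at `(C_s ω, C_t ω)`. [folklore] -/
theorem knLemma3Mixed_indicator_eq {Q : Set (BondConfig V)} {s t : V}
    (hQ : ∀ ω ω', ω ∈ Q → openEdgeCluster ω s ⊆ openEdgeCluster ω' s →
      openEdgeCluster ω' t ⊆ openEdgeCluster ω t → ω' ∈ Q)
    (ω : BondConfig V) :
    {p : Set (Sym2 V) × Set (Sym2 V) | ∃ ω' ∈ Q, openEdgeCluster ω' s ⊆ p.1 ∧
        p.2 ⊆ openEdgeCluster ω' t}.indicator (1 : Set (Sym2 V) × Set (Sym2 V) → ℝ)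
      (openEdgeCluster ω s, openEdgeCluster ω t) = Q.indicator 1 ω := by
  by_cases hω : ω ∈ Q
  · have h1 : (openEdgeCluster ω s, openEdgeCluster ω t) ∈
        {p : Set (Sym2 V) × Set (Sym2 V) | ∃ ω' ∈ Q, openEdgeCluster ω' s ⊆ p.1 ∧
          p.2 ⊆ openEdgeCluster ω' t} :=
      ⟨ω, hω, subset_rfl, subset_rfl⟩
    rw [indicator_of_mem h1, indicator_of_mem hω, Pi.one_apply, Pi.one_apply]
  · have h1 : (openEdgeCluster ω s, openEdgeCluster ω t) ∉
        {p : Set (Sym2 V) × Set (Sym2 V) | ∃ ω' ∈ Q, openEdgeCluster ω' s ⊆ p.1 ∧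
          p.2 ⊆ openEdgeCluster ω' t} := by
      rintro ⟨ω', hω', hsub, hsup⟩
      exact hω (hQ ω' ω hω' hsub hsup)
    rw [indicator_of_notMem h1, indicator_of_notMem hω]

/-- The mixed-closure indicator is increasing in the first variable. [folklore] -/
theorem knLemma3Mixed_indicator_monotone (Q : Set (BondConfig V)) (s t : V) (D : Set (Sym2 V)) :
    Monotone fun C : Set (Sym2 V) =>
      {p : Set (Sym2 V) × Set (Sym2 V) | ∃ ω' ∈ Q, openEdgeCluster ω' s ⊆ p.1 ∧
          p.2 ⊆ openEdgeCluster ω' t}.indicator (1 : Set (Sym2 V) × Set (Sym2 V) → ℝ) (C, D) := by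
  intro C C' hCC'
  by_cases h : (C, D) ∈ {p : Set (Sym2 V) × Set (Sym2 V) | ∃ ω' ∈ Q, openEdgeCluster ω' s ⊆ p.1 ∧
      p.2 ⊆ openEdgeCluster ω' t}
  · obtain ⟨ω', hω', hsub, hsup⟩ := h
    have h1 : (C, D) ∈ {p : Set (Sym2 V) × Set (Sym2 V) | ∃ ω' ∈ Q, openEdgeCluster ω' s ⊆ p.1 ∧
        p.2 ⊆ openEdgeCluster ω' t} := ⟨ω', hω', hsub, hsup⟩
    have h2 : (C', D) ∈ {p : Set (Sym2 V) × Set (Sym2 V) | ∃ ω' ∈ Q, openEdgeCluster ω' s ⊆ p.1 ∧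
        p.2 ⊆ openEdgeCluster ω' t} := ⟨ω', hω', hsub.trans hCC', hsup⟩
    simp only
    rw [indicator_of_mem h1, indicator_of_mem h2, Pi.one_apply, Pi.one_apply]
  · simp only
    rw [indicator_of_notMem h]
    exact indicator_nonneg (fun _ _ => zero_le_one) _

/-- The mixed-closure indicator is decreasing in the second variable. [folklore] -/
theorem knLemma3Mixed_indicator_antitone (Q : Set (BondConfig V)) (s t : V) (C : Set (Sym2 V)) :
    Antitone fun D : Set (Sym2 V) =>
      {p : Set (Sym2 V) × Set (Sym2 V) | ∃ ω' ∈ Q, openEdgeCluster ω' s ⊆ p.1 ∧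
          p.2 ⊆ openEdgeCluster ω' t}.indicator (1 : Set (Sym2 V) × Set (Sym2 V) → ℝ) (C, D) := by
  intro D D' hDD'
  by_cases h : (C, D') ∈ {p : Set (Sym2 V) × Set (Sym2 V) | ∃ ω' ∈ Q, openEdgeCluster ω' s ⊆ p.1 ∧
      p.2 ⊆ openEdgeCluster ω' t}
  · obtain ⟨ω', hω', hsub, hsup⟩ := h
    have h1 : (C, D') ∈ {p : Set (Sym2 V) × Set (Sym2 V) | ∃ ω' ∈ Q, openEdgeCluster ω' s ⊆ p.1 ∧
        p.2 ⊆ openEdgeCluster ω' t} := ⟨ω', hω', hsub, hsup⟩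
    have h2 : (C, D) ∈ {p : Set (Sym2 V) × Set (Sym2 V) | ∃ ω' ∈ Q, openEdgeCluster ω' s ⊆ p.1 ∧
        p.2 ⊆ openEdgeCluster ω' t} := ⟨ω', hω', hsub, hDD'.trans hsup⟩
    simp only
    rw [indicator_of_mem h1, indicator_of_mem h2, Pi.one_apply, Pi.one_apply]
  · simp only
    rw [indicator_of_notMem h]
    exact indicator_nonneg (fun _ _ => zero_le_one) _

variable [Fintype V]

/-- **BHK (2006) Thm. 1.5 with `f = 1_Q` (mixed), `g = 1{s ↔ b}`** (increasing in `C_s`):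
`μ(D ∩ Q) μ(D ∩ {s↔b}) ≤ μ(D) μ(D ∩ (Q ∩ {s↔b}))` for `D = {s ↮ t}`.
[cite: VandenbergHaggstromKahn2005, Thm. 1.5 (p. 7, eq. (9))] -/
theorem knLemma3Mixed_sSide (w : Sym2 V → unitInterval) (s t b : V) (Q : Set (BondConfig V))
    (hQ : ∀ ω ω', ω ∈ Q → openEdgeCluster ω s ⊆ openEdgeCluster ω' s →
      openEdgeCluster ω' t ⊆ openEdgeCluster ω t → ω' ∈ Q) (hst : s ≠ t) :
    (prodBernoulli w).real ((openConn s t)ᶜ ∩ Q) *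
        (prodBernoulli w).real ((openConn s t)ᶜ ∩ openConn s b) ≤
      (prodBernoulli w).real (openConn s t)ᶜ *
        (prodBernoulli w).real ((openConn s t)ᶜ ∩ (Q ∩ openConn s b)) := by
  have key := BHK2006_twoClusterConditionalAssociation_holds V w s t
    (fun C D => {p : Set (Sym2 V) × Set (Sym2 V) | ∃ ω' ∈ Q, openEdgeCluster ω' s ⊆ p.1 ∧
        p.2 ⊆ openEdgeCluster ω' t}.indicator (1 : Set (Sym2 V) × Set (Sym2 V) → ℝ) (C, D))
    (fun C _ => connIndicatorFn s b C)
    (fun D => knLemma3Mixed_indicator_monotone Q s t D)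
    (fun C => knLemma3Mixed_indicator_antitone Q s t C)
    (fun _ => monotone_connIndicatorFn s b) (fun _ => antitone_const) hst
  have hD : {ω : BondConfig V | ¬ (openGraph ω).Reachable s t} = (openConn s t)ᶜ := rfl
  have hma : MeasurableSet (openConn s b : Set (BondConfig V)) := measurableSet_openConn_holds s b
  have hmQ : MeasurableSet Q := MeasurableSet.of_discrete
  simp only [connIndicatorFn_openEdgeCluster, knLemma3Mixed_indicator_eq hQ, hD] at key
  rw [show (fun ω : BondConfig V => Q.indicator (1 : BondConfig V → ℝ) ω *
        (openConn s b).indicator 1 ω) = (Q ∩ openConn s b).indicator 1 from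
      funext fun ω => (congrFun (Set.inter_indicator_one (s := Q)
        (t := openConn s b) (M₀ := ℝ)) ω).symm] at key
  rw [setIntegral_indicator (hmQ.inter hma), setIntegral_indicator hma, setIntegral_indicator hmQ]
    at key
  simpa only [Pi.one_apply, setIntegral_const, smul_eq_mul, mul_one] using key

/-- **BHK (2006) Thm. 1.5 with `f = 1_Q` (mixed), `g = −1{t ↔ b}`** (`1{t ↔ b}` is increasing in
`C_t`, so `−1{t ↔ b}` is decreasing in `C_t`): `μ(D) μ(D ∩ (Q ∩ {t↔b})) ≤ μ(D ∩ Q) μ(D ∩ {t↔b})`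
for `D = {s ↮ t}`. [cite: VandenbergHaggstromKahn2005, Thm. 1.5 (p. 7, eq. (9))] -/
theorem knLemma3Mixed_tSide (w : Sym2 V → unitInterval) (s t b : V) (Q : Set (BondConfig V))
    (hQ : ∀ ω ω', ω ∈ Q → openEdgeCluster ω s ⊆ openEdgeCluster ω' s →
      openEdgeCluster ω' t ⊆ openEdgeCluster ω t → ω' ∈ Q) (hst : s ≠ t) :
    (prodBernoulli w).real (openConn s t)ᶜ *
        (prodBernoulli w).real ((openConn s t)ᶜ ∩ (Q ∩ openConn t b)) ≤
      (prodBernoulli w).real ((openConn s t)ᶜ ∩ Q) *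
        (prodBernoulli w).real ((openConn s t)ᶜ ∩ openConn t b) := by
  have key := BHK2006_twoClusterConditionalAssociation_holds V w s t
    (fun C D => {p : Set (Sym2 V) × Set (Sym2 V) | ∃ ω' ∈ Q, openEdgeCluster ω' s ⊆ p.1 ∧
        p.2 ⊆ openEdgeCluster ω' t}.indicator (1 : Set (Sym2 V) × Set (Sym2 V) → ℝ) (C, D))
    (fun _ D => -connIndicatorFn t b D)
    (fun D => knLemma3Mixed_indicator_monotone Q s t D)
    (fun C => knLemma3Mixed_indicator_antitone Q s t C)
    (fun _ => monotone_const) (fun _ _ _ hDD' => neg_le_neg (monotone_connIndicatorFn t b hDD')) hst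
  have hD : {ω : BondConfig V | ¬ (openGraph ω).Reachable s t} = (openConn s t)ᶜ := rfl
  have hma : MeasurableSet (openConn t b : Set (BondConfig V)) := measurableSet_openConn_holds t b
  have hmQ : MeasurableSet Q := MeasurableSet.of_discrete
  simp only [connIndicatorFn_openEdgeCluster, knLemma3Mixed_indicator_eq hQ, hD, mul_neg,
    integral_neg] at key
  rw [show (fun ω : BondConfig V => Q.indicator (1 : BondConfig V → ℝ) ω *
        (openConn t b).indicator 1 ω) = (Q ∩ openConn t b).indicator 1 from
      funext fun ω => (congrFun (Set.inter_indicator_one (s := Q)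
        (t := openConn t b) (M₀ := ℝ)) ω).symm] at key
  rw [setIntegral_indicator (hmQ.inter hma), setIntegral_indicator hma, setIntegral_indicator hmQ]
    at key
  simp only [Pi.one_apply, setIntegral_const, smul_eq_mul, mul_one] at key
  linarith

end General

/-- Real-arithmetic core: `m y₁ ≤ x₁ q`, `x₂ q ≤ m y₂`, `x₁ ≤ x₂ + d`, `0 ≤ q ≤ m`, `0 ≤ d`,
`y₁ ≤ m`, `0 ≤ y₂` give `y₁ ≤ y₂ + d`. [folklore] -/
theorem knLemma3Mixed_arith {m x₁ x₂ y₁ y₂ q d : ℝ}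
    (hd : 0 ≤ d) (hq0 : 0 ≤ q) (hqm : q ≤ m) (hy₂0 : 0 ≤ y₂) (hy₁m : y₁ ≤ m)
    (hI : m * y₁ ≤ x₁ * q) (hII : x₂ * q ≤ m * y₂) (hx : x₁ ≤ x₂ + d) :
    y₁ ≤ y₂ + d := by
  have hm : 0 ≤ m := hq0.trans hqm
  rcases eq_or_lt_of_le hm with hm0 | hmpos
  · rw [← hm0] at hy₁m
    linarith
  · refine le_of_mul_le_mul_left ?_ hmpos
    calc m * y₁ ≤ x₁ * q := hI
      _ ≤ (x₂ + d) * q := mul_le_mul_of_nonneg_right hx hq0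
      _ = x₂ * q + d * q := add_mul _ _ _
      _ ≤ m * y₂ + d * m := add_le_add hII (mul_le_mul_of_nonneg_left hqm hd)
      _ = m * (y₂ + d) := by ring

/-- **Kozma–Nitzan Lemma 3 for mixed-monotone conditioning events** (arXiv:2401.12397 Lemma 3,
pp. 6–7, common generalisation of parts (i) and (ii); denominator-free).  If
`P(a₁ ↔ b) ≤ P(a₂ ↔ b) + d` (`d ≥ 0`) and `Q` is a mixed-monotone function of the pair of open edge
clusters — `ω ∈ Q`, `C_{a₂} ω ⊆ C_{a₂} ω'`, `C_{a₁} ω' ⊆ C_{a₁} ω` ⇒ `ω' ∈ Q` (increasing in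
`C_{a₂}`, decreasing in `C_{a₁}`) — then `P({a₁ ↔ b} ∩ Q) ≤ P({a₂ ↔ b} ∩ Q) + d`.  From
van den Berg–Häggström–Kahn 2006 Thm. 1.5 (proved in the tree), used twice on `D = {a₂ ↮ a₁}`.
[cite: KozmaNitzan2024, Lemma 3 (pp. 6–7)] [cite: VandenbergHaggstromKahn2005, Thm. 1.5] -/
theorem knLemma3Mixed :
    ∀ (n : ℕ) (w : Sym2 (Fin n) → unitInterval) (a₁ a₂ b : Fin n) (Q : Set (BondConfig (Fin n)))
      (d : ℝ),
      (∀ ω ω' : BondConfig (Fin n), ω ∈ Q → openEdgeCluster ω a₂ ⊆ openEdgeCluster ω' a₂ →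
        openEdgeCluster ω' a₁ ⊆ openEdgeCluster ω a₁ → ω' ∈ Q) →
      0 ≤ d →
      (prodBernoulli w).real (openConn a₁ b) ≤ (prodBernoulli w).real (openConn a₂ b) + d →
      (prodBernoulli w).real (openConn a₁ b ∩ Q) ≤ (prodBernoulli w).real (openConn a₂ b ∩ Q) + d
    := by
  intro n w a₁ a₂ b Q d hQ hd hle
  rcases eq_or_ne a₁ a₂ with h12 | h12
  · subst h12
    exact le_add_of_nonneg_right hd
  -- `D = {a₁ ↮ a₂} = (openConn a₁ a₂)ᶜ`
  have hDm : MeasurableSet ((openConn a₁ a₂)ᶜ : Set (BondConfig (Fin n))) :=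
    MeasurableSet.of_discrete
  -- (1) on `{a₁ ↔ a₂}` the events `{a₁ ↔ b}` and `{a₂ ↔ b}` coincide
  have hagree : ∀ E : Set (BondConfig (Fin n)),
      (openConn a₁ b ∩ E) \ (openConn a₁ a₂)ᶜ = (openConn a₂ b ∩ E) \ (openConn a₁ a₂)ᶜ := by
    intro E
    ext ω
    simp only [Set.mem_sdiff, Set.mem_inter_iff, Set.mem_compl_iff, not_not]
    constructor
    · rintro ⟨⟨h1, hE⟩, h2⟩
      exact ⟨⟨SimpleGraph.Reachable.trans (SimpleGraph.Reachable.symm h2) h1, hE⟩, h2⟩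
    · rintro ⟨⟨h1, hE⟩, h2⟩
      exact ⟨⟨SimpleGraph.Reachable.trans h2 h1, hE⟩, h2⟩
  have hs1 := measureReal_inter_add_sdiff (μ := prodBernoulli w) (s := openConn a₁ b) hDm
  have hs2 := measureReal_inter_add_sdiff (μ := prodBernoulli w) (s := openConn a₂ b) hDm
  have hs1Q := measureReal_inter_add_sdiff (μ := prodBernoulli w) (s := openConn a₁ b ∩ Q) hDm
  have hs2Q := measureReal_inter_add_sdiff (μ := prodBernoulli w) (s := openConn a₂ b ∩ Q) hDm
  have he : (prodBernoulli w).real (openConn a₁ b \ (openConn a₁ a₂)ᶜ) =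
      (prodBernoulli w).real (openConn a₂ b \ (openConn a₁ a₂)ᶜ) := by
    have h := hagree Set.univ
    simp only [Set.inter_univ] at h
    rw [h]
  have heQ : (prodBernoulli w).real ((openConn a₁ b ∩ Q) \ (openConn a₁ a₂)ᶜ) =
      (prodBernoulli w).real ((openConn a₂ b ∩ Q) \ (openConn a₁ a₂)ᶜ) := by
    rw [hagree Q]
  rw [Set.inter_comm (openConn a₁ b) (openConn a₁ a₂)ᶜ] at hs1
  rw [Set.inter_comm (openConn a₂ b) (openConn a₁ a₂)ᶜ] at hs2
  rw [Set.inter_comm (openConn a₁ b ∩ Q) (openConn a₁ a₂)ᶜ] at hs1Q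
  rw [Set.inter_comm (openConn a₂ b ∩ Q) (openConn a₁ a₂)ᶜ] at hs2Q
  -- (2) the two BHK Thm. 1.5 bounds (`s = a₂`, `t = a₁`), rewritten to `D = (openConn a₁ a₂)ᶜ`
  have hcomm : (openConn a₂ a₁ : Set (BondConfig (Fin n))) = openConn a₁ a₂ :=
    Set.ext fun _ => ⟨fun h => SimpleGraph.Reachable.symm h, fun h => SimpleGraph.Reachable.symm h⟩
  have hI := knLemma3Mixed_tSide w a₂ a₁ b Q hQ h12.symm
  have hII := knLemma3Mixed_sSide w a₂ a₁ b Q hQ h12.symm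
  rw [hcomm] at hI hII
  rw [Set.inter_comm Q (openConn a₁ b)] at hI
  rw [Set.inter_comm Q (openConn a₂ b)] at hII
  -- (3) combine
  have hx : (prodBernoulli w).real ((openConn a₁ a₂)ᶜ ∩ openConn a₁ b) ≤
      (prodBernoulli w).real ((openConn a₁ a₂)ᶜ ∩ openConn a₂ b) + d := by
    linarith
  have hqm : (prodBernoulli w).real ((openConn a₁ a₂)ᶜ ∩ Q) ≤
      (prodBernoulli w).real ((openConn a₁ a₂)ᶜ : Set (BondConfig (Fin n))) :=
    measureReal_mono Set.inter_subset_left (measure_ne_top _ _)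
  have hy₁m : (prodBernoulli w).real ((openConn a₁ a₂)ᶜ ∩ (openConn a₁ b ∩ Q)) ≤
      (prodBernoulli w).real ((openConn a₁ a₂)ᶜ : Set (BondConfig (Fin n))) :=
    measureReal_mono Set.inter_subset_left (measure_ne_top _ _)
  have hfin : (prodBernoulli w).real ((openConn a₁ a₂)ᶜ ∩ (openConn a₁ b ∩ Q)) ≤
      (prodBernoulli w).real ((openConn a₁ a₂)ᶜ ∩ (openConn a₂ b ∩ Q)) + d :=
    knLemma3Mixed_arith hd measureReal_nonneg hqm measureReal_nonneg hy₁m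
      (by simpa only [mul_comm] using hI) (by simpa only [mul_comm] using hII) hx
  linarith

/-- **The set-observer case** (model application).  For a finite set `S` of vertices let
`Q_S = {S ↔ a₂} ∩ {S ↮ a₁}` (some vertex of `S` is joined to `a₂` by an open path and no vertex of
`S` is joined to `a₁`).  `Q_S` is increasing in `C_{a₂}` and decreasing in `C_{a₁}`, hence: if
`P(a₁ ↔ b) ≤ P(a₂ ↔ b) + d` (`d ≥ 0`) then `P({a₁ ↔ b} ∩ Q_S) ≤ P({a₂ ↔ b} ∩ Q_S) + d`.  This is the
star-by-star term of the σ-decomposition proving Kozma–Nitzan Lemma 3(i) at `Q = {o ↔ a₂}` under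
the order of `a₁, a₂` in `G ∖ o` (KN Question 9 for `|A| = 2`).
[cite: KozmaNitzan2024, Lemma 3 (pp. 6–7) and Question 9 (p. 36)] -/
theorem knLemma3Mixed_setObserver :
    ∀ (n : ℕ) (w : Sym2 (Fin n) → unitInterval) (a₁ a₂ b : Fin n) (S : Finset (Fin n)) (d : ℝ),
      0 ≤ d →
      (prodBernoulli w).real (openConn a₁ b) ≤ (prodBernoulli w).real (openConn a₂ b) + d →
      (prodBernoulli w).real (openConn a₁ b ∩
          {ω : BondConfig (Fin n) | (∃ y ∈ S, (openGraph ω).Reachable a₂ y) ∧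
            ∀ y ∈ S, ¬ (openGraph ω).Reachable a₁ y}) ≤
        (prodBernoulli w).real (openConn a₂ b ∩
          {ω : BondConfig (Fin n) | (∃ y ∈ S, (openGraph ω).Reachable a₂ y) ∧
            ∀ y ∈ S, ¬ (openGraph ω).Reachable a₁ y}) + d := by
  intro n w a₁ a₂ b S d hd hle
  refine knLemma3Mixed n w a₁ a₂ b _ d ?_ hd hle
  rintro ω ω' ⟨⟨y, hyS, hy⟩, hno⟩ h2 h1
  refine ⟨⟨y, hyS, ?_⟩, fun z hzS hz => hno z hzS ?_⟩
  · rcases (reachable_iff_exists_mem_openEdgeCluster ω a₂ y).1 hy with rfl | ⟨e, he, hye⟩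
    · exact SimpleGraph.Reachable.refl _
    · exact (reachable_iff_exists_mem_openEdgeCluster ω' a₂ _).2 (Or.inr ⟨e, h2 he, hye⟩)
  · rcases (reachable_iff_exists_mem_openEdgeCluster ω' a₁ z).1 hz with rfl | ⟨e, he, hze⟩
    · exact SimpleGraph.Reachable.refl _
    · exact (reachable_iff_exists_mem_openEdgeCluster ω a₁ _).2 (Or.inr ⟨e, h1 he, hze⟩)

/-- **Per-star form for a glued observer set.**  Under the same hypotheses,
`P({a₁ ↔ b} ∩ Q_S) ≤ P({S ↔ b} ∩ Q_S) + d` with `Q_S = {S ↔ a₂} ∩ {S ↮ a₁}`: on `Q_S` the event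
`{a₂ ↔ b}` forces `{S ↔ b}`.  Summed over the open star `S` of an observer `o` (σ-decomposition) this is
`P(a₁ ↔ b, o ↔ a₂) ≤ P(a₂ ↔ b, o ↔ a₂)` in `G` under the order of `a₁, a₂` in `G ∖ o`; for a sure
star `S` it is the same inequality for the quotient `H/S` under the order in `H`.
[cite: KozmaNitzan2024, Lemma 3 (pp. 6–7) and Question 9 (p. 36)] -/
theorem knLemma3Mixed_setObserver_star :
    ∀ (n : ℕ) (w : Sym2 (Fin n) → unitInterval) (a₁ a₂ b : Fin n) (S : Finset (Fin n)) (d : ℝ),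
      0 ≤ d →
      (prodBernoulli w).real (openConn a₁ b) ≤ (prodBernoulli w).real (openConn a₂ b) + d →
      (prodBernoulli w).real (openConn a₁ b ∩
          {ω : BondConfig (Fin n) | (∃ y ∈ S, (openGraph ω).Reachable a₂ y) ∧
            ∀ y ∈ S, ¬ (openGraph ω).Reachable a₁ y}) ≤
        (prodBernoulli w).real ({ω : BondConfig (Fin n) | ∃ y ∈ S, (openGraph ω).Reachable y b} ∩
          {ω : BondConfig (Fin n) | (∃ y ∈ S, (openGraph ω).Reachable a₂ y) ∧
            ∀ y ∈ S, ¬ (openGraph ω).Reachable a₁ y}) + d := by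
  intro n w a₁ a₂ b S d hd hle
  refine (knLemma3Mixed_setObserver n w a₁ a₂ b S d hd hle).trans (add_le_add_left ?_ d)
  refine measureReal_mono ?_ (measure_ne_top _ _)
  rintro ω ⟨hab, ⟨y, hyS, hy⟩, hno⟩
  exact ⟨⟨y, hyS, (SimpleGraph.Reachable.symm hy).trans hab⟩, ⟨y, hyS, hy⟩, hno⟩

/-- Registered siege sub-goal `stub_knLemma3Mixed_k31` (= `knLemma3Mixed`, verbatim signature). -/
theorem stub_knLemma3Mixed_k31 :
    ∀ (n : ℕ) (w : Sym2 (Fin n) → unitInterval) (a₁ a₂ b : Fin n) (Q : Set (BondConfig (Fin n)))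
      (d : ℝ),
      (∀ ω ω' : BondConfig (Fin n), ω ∈ Q → openEdgeCluster ω a₂ ⊆ openEdgeCluster ω' a₂ →
        openEdgeCluster ω' a₁ ⊆ openEdgeCluster ω a₁ → ω' ∈ Q) →
      0 ≤ d →
      (prodBernoulli w).real (openConn a₁ b) ≤ (prodBernoulli w).real (openConn a₂ b) + d →
      (prodBernoulli w).real (openConn a₁ b ∩ Q) ≤ (prodBernoulli w).real (openConn a₂ b ∩ Q) + d :=
  knLemma3Mixed

end

end Summit.CriticalPhenomena.PercolationContinuityZ3.Theorems
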